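import Literature.AnabelianGeometry.SemiGraphs.PSCSeparatingCoveringsThreeChainPointed
import Literature.AnabelianGeometry.SemiGraphs.PSCSeparatingCoveringsTwoComponentUnmarkedEdgesOneCusp
import Literature.AnabelianGeometry.SemiGraphs.PSCSeparatingCoveringsTwoComponentAffineEdges
import HarnessLib

/-!
# [CombGC] Prop. 1.2, proof p. 9: VERTICIAL separating coverings at THREE-COMPONENT CHAINS with BOTH END components UNMARKED (row F-2826)

Mochizuki, *A combinatorial version of the Grothendieck conjecture*, Tohoku Math. J. **59** (2007)
[CombGC], PROOF of Proposition 1.2, p. 9: "if `v₁ ≠ v₂` …, then there exists a finite étale … covering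
`G' → G` whose restriction to the anabelioid `G_{v₂}` is trivial …, but whose restriction to `G_{v₁}` is
nontrivial" [cite: MochizukiCombGC2007, Prop 1.2 proof p.9]; typed LEVEL-WISE as
`PSCDatum.VerticialSeparatingCoverings` (abc-iut-w4-d081, row P12-L01-V; abc-iut FACT-LIST row F-2826 — a
schema whose universal closure is refuted as typed; the instance forms at genuine carriers are the content).

PROOF-ONLY file (abc-iut-f-166 gen 6, row «BOTH-ENDS-UNMARKED-CHAIN», file 2; 0 definitions).  The carrier:
abc-iut-f-164's three-component chain `C₀ ∪_{ν_A} C_mid ∪_{ν_B} C₁` with BOTH END components UNMARKED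
(`s₁ = 0`, `s₂ = r ≥ 2`, `1 ≤ g₀ ≤ g₁ < g`), over a profinite pro-`Σ` completion `ι : Γ_{g,r} → Π`.  In the
`c₀`-eliminating basis `b₀ = (a_i, b_i, c_{j+1})` the end vertex groups `Π_{v₀} = cl ι⟨a_i, b_i (i < g₀)⟩`,
`Π_{v₁} = cl ι⟨a_i, b_i (i ≥ g₁)⟩ ∋ ι(η)` are free-factor closures, while the MIDDLE vertex group is
`Π_{v_mid} = cl ι⟨b₀(S_mid) ∪ {ε_A, η}⟩` (`closure_chainMid_unmarkedEnds_eq`: `c₀` recovered from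
`η = c₀ (c₁⋯c_{r−1}) ε_A ∏_{g₀≤i<g₁}[a_i,b_i]`) — free letters plus TWO boundary words, `ε_A = ∏_{i<g₀}[a_i,b_i]`
of the `C₀`-handles and `η ∈ ⟨a_i, b_i : i ≥ g₁⟩` (the image of `c₀` under abc-iut-f-164's closed-component
embedding `θ`): exactly the CUT-OFF shape of abc-iut-f-164's `cutoff_exists_open_separating_sameVertex` with
`E = {ε_A, η}` and `Ψ` the dual of a cusp letter.  Cross pairs: free-factor projections with letter witnesses
(`c_{r−1}`, `a_0`, `a_{g₁}`), and — for the killed middle vertex — the handle character `a_{i₀}^∨` mod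
`ℓ^{[Π:V]}` (trivial on every `c_j`, hence on `ε_A` and `η`) through `exists_open_separating_of_hom`.

* `closure_chainMid_unmarkedEnds_eq` — the middle vertex group in the basis `b₀`;
* `verticialSeparatingCoverings_of_threeChain_unmarkedEnds` — **F-2826** (`V' := V`) at EVERY such datum.

(`r = 1`: the middle index set may be empty — not in this file.)  Instance forms at data of the shape of
genuine stable curves: consistency evidence for the typed schema, not the printed theorem for all pointed
stable curves.  Nothing here takes a side on [IUTchIII] Cor. 3.12.
-/

noncomputable section

/-! ### The middle vertex group when both end components are unmarked -/

namespace Literature.GroupTheory.CombinatorialGroupTheory.PuncturedSurfaceGroup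

variable {g r' g₀ g₁ : ℕ} {εA η : PuncturedSurfaceGroup g (r' + 1)}
  {B : FreeGroupBasis ((Fin g × Bool) ⊕ Fin r') (PuncturedSurfaceGroup g (r' + 1))}

/-- **The middle component of a chain whose end components are both unmarked**, in the `c₀`-eliminating
basis `B = (a_i, b_i, c_{j+1})`: for `g₀ ≤ g₁`,
`⟨a_i, b_i (g₀ ≤ i < g₁), c_j (all j), ε_A, η⟩ = ⟨B(S_mid) ∪ {ε_A, η}⟩`, `S_mid = {(i,·) : g₀ ≤ i < g₁} ∪ {all j}`
— the marked point `c₀` is recovered from `η = c₀ (c₁⋯c_{r'}) ε_A ∏_{g₀≤i<g₁}[a_i,b_i]` (`secondLoop_eq_c_mul`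
with `s₁ = 0`, `s₂ = r' + 1`). [cite: MochizukiSemiAnbd2006, Ex. 2.10 p.31] -/
theorem closure_chainMid_unmarkedEnds_eq
    (hεA : εA = ((List.finRange (r' + 1)).map fun j : Fin (r' + 1) =>
        if r' + 1 ≤ (j : ℕ) then c (g := g) j else 1).prod *
      ((List.finRange g).map fun i : Fin g => if (i : ℕ) < g₀ then
        a (r := r' + 1) i * b i * (a i)⁻¹ * (b i)⁻¹ else 1).prod)
    (hη : η = ((List.finRange (r' + 1)).map fun j : Fin (r' + 1) =>
        if 0 ≤ (j : ℕ) then c (g := g) j else 1).prod *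
      ((List.finRange g).map fun i : Fin g => if (i : ℕ) < g₁ then
        a (r := r' + 1) i * b i * (a i)⁻¹ * (b i)⁻¹ else 1).prod)
    (ha : ∀ i, B (Sum.inl (i, false)) = a i) (hb : ∀ i, B (Sum.inl (i, true)) = b i)
    (hc : ∀ j : Fin r', B (Sum.inr j) = c (Fin.succ j)) (hg : g₀ ≤ g₁) :
    Subgroup.closure {x : PuncturedSurfaceGroup g (r' + 1) |
        (∃ i : Fin g, (g₀ ≤ (i : ℕ) ∧ (i : ℕ) < g₁) ∧ (x = a i ∨ x = b i)) ∨
          (∃ j : Fin (r' + 1), (0 ≤ (j : ℕ) ∧ (j : ℕ) < r' + 1) ∧ x = c j) ∨ x = εA ∨ x = η} =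
      Subgroup.closure (B '' {x | Sum.elim (fun p : Fin g × Bool => g₀ ≤ (p.1 : ℕ) ∧ (p.1 : ℕ) < g₁)
        (fun _ : Fin r' => True) x} ∪ {εA, η}) := by
  classical
  set Sm : Set ((Fin g × Bool) ⊕ Fin r') := {x | Sum.elim (fun p : Fin g × Bool => g₀ ≤ (p.1 : ℕ) ∧ (p.1 : ℕ) < g₁)
    (fun _ : Fin r' => True) x} with hSm
  have hml : ∀ p : Fin g × Bool, (Sum.inl p : (Fin g × Bool) ⊕ Fin r') ∈ Sm ↔
      g₀ ≤ (p.1 : ℕ) ∧ (p.1 : ℕ) < g₁ := fun _ => Iff.rfl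
  have hmr : ∀ j : Fin r', (Sum.inr j : (Fin g × Bool) ⊕ Fin r') ∈ Sm := fun _ => trivial
  set R := Subgroup.closure (B '' Sm ∪ {εA, η}) with hR
  have hmemR : ∀ x, x ∈ Sm → B x ∈ R := fun x hx => Subgroup.subset_closure (Or.inl ⟨x, hx, rfl⟩)
  have hεR : εA ∈ R := Subgroup.subset_closure (Or.inr (Set.mem_insert _ _))
  have hηR : η ∈ R := Subgroup.subset_closure (Or.inr (Set.mem_insert_of_mem _ rfl))
  have haR : ∀ i : Fin g, g₀ ≤ (i : ℕ) → (i : ℕ) < g₁ → a (r := r' + 1) i ∈ R := fun i h1 h2 => by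
    rw [← ha i]; exact hmemR _ ((hml _).mpr ⟨h1, h2⟩)
  have hbR : ∀ i : Fin g, g₀ ≤ (i : ℕ) → (i : ℕ) < g₁ → b (r := r' + 1) i ∈ R := fun i h1 h2 => by
    rw [← hb i]; exact hmemR _ ((hml _).mpr ⟨h1, h2⟩)
  -- `c_j ∈ R` for `1 ≤ j ≤ r'` (basis members)
  have hcR : ∀ j : Fin (r' + 1), 1 ≤ (j : ℕ) → c (g := g) j ∈ R := by
    intro j hj1
    have hj0 : (j : ℕ) ≠ 0 := by omega
    have e1 : B (Sum.inr (j.pred (fun h => hj0 (by rw [h]; rfl)))) = c j := by rw [hc, Fin.succ_pred]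
    rw [← e1]
    exact hmemR _ (hmr _)
  -- `c_0 ∈ R`: `η = c_0 · W`, `W ∈ R`
  have hc0R : c (g := g) ⟨0, by omega⟩ ∈ R := by
    have hW : ((List.finRange (r' + 1)).map fun j : Fin (r' + 1) =>
          if 0 + 1 ≤ (j : ℕ) ∧ (j : ℕ) < r' + 1 then c (g := g) j else 1).prod * εA *
        ((List.finRange g).map fun i : Fin g => if g₀ ≤ (i : ℕ) ∧ (i : ℕ) < g₁ then
          a (r := r' + 1) i * b i * (a i)⁻¹ * (b i)⁻¹ else 1).prod ∈ R :=
      R.mul_mem (R.mul_mem (prod_map_finRange_ite_mem _ _ _ _ fun j hj => hcR j (by omega)) hεR)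
        (comm_prod_ite_mem _ _ (fun i hi => haR i hi.1 hi.2) (fun i hi => hbR i hi.1 hi.2))
    have hrel := secondLoop_eq_c_mul (s₁ := 0) (s₂ := r' + 1) hεA hη hg (by omega) (by omega)
    rw [eq_mul_inv_of_mul_eq hrel.symm]
    exact R.mul_mem hηR (R.inv_mem hW)
  apply le_antisymm
  · rw [Subgroup.closure_le]
    rintro x (⟨i, ⟨h1, h2⟩, rfl | rfl⟩ | ⟨j, -, rfl⟩ | rfl | rfl)
    · exact haR i h1 h2
    · exact hbR i h1 h2
    · by_cases hj0 : (j : ℕ) = 0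
      · have : j = ⟨0, by omega⟩ := Fin.ext hj0
        rw [this]; exact hc0R
      · exact hcR j (by omega)
    · exact hεR
    · exact hηR
  · rw [Subgroup.closure_le]
    rintro x (⟨y, hy, rfl⟩ | rfl | rfl)
    · apply Subgroup.subset_closure
      rcases y with ⟨i, _ | _⟩ | j
      · exact Or.inl ⟨i, (hml _).mp hy, Or.inl (ha i)⟩
      · exact Or.inl ⟨i, (hml _).mp hy, Or.inr (hb i)⟩
      · rw [hc j]
        exact Or.inr (Or.inl ⟨Fin.succ j, ⟨Nat.zero_le _, (Fin.succ j).isLt⟩, rfl⟩)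
    · exact Subgroup.subset_closure (Or.inr (Or.inr (Or.inl rfl)))
    · exact Subgroup.subset_closure (Or.inr (Or.inr (Or.inr rfl)))

end Literature.GroupTheory.CombinatorialGroupTheory.PuncturedSurfaceGroup

namespace Literature.AnabelianGeometry.SemiGraphs

namespace PSCDatum

open scoped Pointwise
open Multiplicative
open Literature.AnabelianGeometry.Anabelioids (IsSigmaInteger)
open Literature.GroupTheory.CombinatorialGroupTheory
open Literature.GroupTheory.CombinatorialGroupTheory.PuncturedSurfaceGroup (a b c
  exists_freeGroupBasis_elim_zero exists_hom_closedComponent closure_chainMid_unmarkedEnds_eq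
  comm_prod_ite_mem exists_handleCuspCharacter)
open Literature.GroupTheory.CombinatorialGroupTheory.FreeFactorFibredTwist (lift_apply_basis)
open SemiGraphOfAnabelioids (IsProSigmaCompletion)
open SemiGraphOfAnabelioids.IsProSigmaCompletion (freeFactor_exists_open_separating_sameVertex
  freeFactor_exists_open_separating_crossVertex cutoff_exists_open_separating_sameVertex
  exists_open_separating_of_hom)
open TwoComponentAffine (character_nodeLoop)

variable {P : Type} [Group P] [TopologicalSpace P] [IsTopologicalGroup P]
variable [CompactSpace P] [TotallyDisconnectedSpace P] {Sigma : Set ℕ} {g r : ℕ}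

/-- **Row P12-L01-V / F-2826 (`VerticialSeparatingCoverings`, `V' := V`) at EVERY three-component chain datum
whose two END components are UNMARKED** (`s₁ = 0`, `s₂ = r ≥ 2`, `1 ≤ g₀ ≤ g₁ < g`).
[cite: MochizukiCombGC2007, Prop 1.2 proof p.9] -/
theorem verticialSeparatingCoverings_of_threeChain_unmarkedEnds (hne : Sigma.Nonempty)
    (hprime : ∀ p ∈ Sigma, p.Prime) (ι : PuncturedSurfaceGroup g r →* P)
    (hι : IsProSigmaCompletion Sigma ι) (G : PSCDatum P) {g₀ g₁ s₁ s₂ : ℕ} (hg₀ : 1 ≤ g₀) (hg : g₀ ≤ g₁)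
    (hg₁ : g₁ < g) (hs₁ : s₁ = 0) (hs₂ : s₂ = r) (hr : 2 ≤ r)
    (v₀ vm v₁ : G.graph.V) (hV : ∀ w, w = v₀ ∨ w = vm ∨ w = v₁) (εA η : PuncturedSurfaceGroup g r)
    (hεA : εA = ((List.finRange r).map fun j : Fin r =>
          if s₂ ≤ (j : ℕ) then PuncturedSurfaceGroup.c (g := g) j else 1).prod *
        ((List.finRange g).map fun i : Fin g => if (i : ℕ) < g₀ then
          PuncturedSurfaceGroup.a (r := r) i * PuncturedSurfaceGroup.b i *
            (PuncturedSurfaceGroup.a i)⁻¹ * (PuncturedSurfaceGroup.b i)⁻¹ else 1).prod)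
    (hη : η = ((List.finRange r).map fun j : Fin r =>
          if s₁ ≤ (j : ℕ) then PuncturedSurfaceGroup.c (g := g) j else 1).prod *
        ((List.finRange g).map fun i : Fin g => if (i : ℕ) < g₁ then
          PuncturedSurfaceGroup.a (r := r) i * PuncturedSurfaceGroup.b i *
            (PuncturedSurfaceGroup.a i)⁻¹ * (PuncturedSurfaceGroup.b i)⁻¹ else 1).prod)
    (hV₀ : G.vertGp v₀ = ((Subgroup.closure {x : PuncturedSurfaceGroup g r |
        (∃ i : Fin g, (i : ℕ) < g₀ ∧ (x = PuncturedSurfaceGroup.a i ∨ x = PuncturedSurfaceGroup.b i)) ∨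
        ∃ j : Fin r, s₂ ≤ (j : ℕ) ∧ x = PuncturedSurfaceGroup.c j}).map ι).topologicalClosure)
    (hVm : G.vertGp vm = ((Subgroup.closure {x : PuncturedSurfaceGroup g r |
        (∃ i : Fin g, (g₀ ≤ (i : ℕ) ∧ (i : ℕ) < g₁) ∧
          (x = PuncturedSurfaceGroup.a i ∨ x = PuncturedSurfaceGroup.b i)) ∨
        (∃ j : Fin r, (s₁ ≤ (j : ℕ) ∧ (j : ℕ) < s₂) ∧ x = PuncturedSurfaceGroup.c j) ∨
        x = εA ∨ x = η}).map ι).topologicalClosure)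
    (hV₁ : G.vertGp v₁ = ((Subgroup.closure {x : PuncturedSurfaceGroup g r |
        (∃ i : Fin g, g₁ ≤ (i : ℕ) ∧ (x = PuncturedSurfaceGroup.a i ∨ x = PuncturedSurfaceGroup.b i)) ∨
        (∃ j : Fin r, (j : ℕ) < s₁ ∧ x = PuncturedSurfaceGroup.c j) ∨ x = η}).map ι).topologicalClosure) :
    G.VerticialSeparatingCoverings := by
  classical
  subst hs₁
  subst s₂
  obtain ⟨r', rfl⟩ : ∃ r', r = r' + 1 := ⟨r - 1, by omega⟩
  obtain ⟨g₂, rfl⟩ : ∃ g₂, g = g₁ + g₂ := ⟨g - g₁, by omega⟩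
  obtain ⟨ℓ, hℓS⟩ := hne
  have hℓ : ℓ.Prime := hprime ℓ hℓS
  have hSig : ∃ ℓ ∈ Sigma, ℓ.Prime := ⟨ℓ, hℓS, hℓ⟩
  -- the `c₀`-eliminating basis and the closed component `⟨a_i, b_i : i ≥ g₁⟩ ∋ η`
  obtain ⟨bS, ha, hb, hc⟩ := exists_freeGroupBasis_elim_zero (g₁ + g₂) r'
  obtain ⟨θ, -, -, -, hθc, hθrange⟩ := exists_hom_closedComponent (g₀ := g₁) (g₁ := g₂) (r' := r') η hη
  have hηcl : η ∈ Subgroup.closure {x : PuncturedSurfaceGroup (g₁ + g₂) (r' + 1) |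
      ∃ i : Fin (g₁ + g₂), g₁ ≤ (i : ℕ) ∧ (x = a i ∨ x = b i)} := by
    rw [← hθrange, ← hθc]; exact ⟨_, rfl⟩
  -- the three index sets
  obtain ⟨S₀, hS₀⟩ : ∃ S : Set ((Fin (g₁ + g₂) × Bool) ⊕ Fin r'),
      S = {x | Sum.elim (fun p : Fin (g₁ + g₂) × Bool => (p.1 : ℕ) < g₀) (fun _ : Fin r' => False) x} :=
    ⟨_, rfl⟩
  obtain ⟨Sm, hSm⟩ : ∃ S : Set ((Fin (g₁ + g₂) × Bool) ⊕ Fin r'),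
      S = {x | Sum.elim (fun p : Fin (g₁ + g₂) × Bool => g₀ ≤ (p.1 : ℕ) ∧ (p.1 : ℕ) < g₁)
        (fun _ : Fin r' => True) x} := ⟨_, rfl⟩
  obtain ⟨S₁, hS₁⟩ : ∃ S : Set ((Fin (g₁ + g₂) × Bool) ⊕ Fin r'),
      S = {x | Sum.elim (fun p : Fin (g₁ + g₂) × Bool => g₁ ≤ (p.1 : ℕ)) (fun _ : Fin r' => False) x} :=
    ⟨_, rfl⟩
  have h0l : ∀ p : Fin (g₁ + g₂) × Bool, (Sum.inl p : (Fin (g₁ + g₂) × Bool) ⊕ Fin r') ∈ S₀ ↔ (p.1 : ℕ) < g₀ :=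
    fun _ => by rw [hS₀]; exact Iff.rfl
  have h0r : ∀ j : Fin r', (Sum.inr j : (Fin (g₁ + g₂) × Bool) ⊕ Fin r') ∉ S₀ := fun _ h => by
    rw [hS₀] at h; exact h
  have hml : ∀ p : Fin (g₁ + g₂) × Bool, (Sum.inl p : (Fin (g₁ + g₂) × Bool) ⊕ Fin r') ∈ Sm ↔
      g₀ ≤ (p.1 : ℕ) ∧ (p.1 : ℕ) < g₁ := fun _ => by rw [hSm]; exact Iff.rfl
  have hmr : ∀ j : Fin r', (Sum.inr j : (Fin (g₁ + g₂) × Bool) ⊕ Fin r') ∈ Sm := fun _ => by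
    rw [hSm]; exact trivial
  have h1l : ∀ p : Fin (g₁ + g₂) × Bool, (Sum.inl p : (Fin (g₁ + g₂) × Bool) ⊕ Fin r') ∈ S₁ ↔ g₁ ≤ (p.1 : ℕ) :=
    fun _ => by rw [hS₁]; exact Iff.rfl
  have h1r : ∀ j : Fin r', (Sum.inr j : (Fin (g₁ + g₂) × Bool) ⊕ Fin r') ∉ S₁ := fun _ h => by
    rw [hS₁] at h; exact h
  -- `ε_A` is the closed-surface loop `∏_{i<g₀}[a_i,b_i]`, a word in the `C₀` letters; `η` in the `C₁` letters
  have hcusp1 : ((List.finRange (r' + 1)).map fun j : Fin (r' + 1) =>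
      if r' + 1 ≤ (j : ℕ) then PuncturedSurfaceGroup.c (g := g₁ + g₂) j else 1).prod = 1 :=
    List.prod_eq_one fun y hy => by
      obtain ⟨j, -, rfl⟩ := List.mem_map.mp hy
      exact if_neg (by omega)
  have hεx : εA = ((List.finRange (g₁ + g₂)).map fun i : Fin (g₁ + g₂) => if (i : ℕ) < g₀ then
      a (r := r' + 1) i * b i * (a i)⁻¹ * (b i)⁻¹ else 1).prod := by rw [hεA, hcusp1, one_mul]
  have hεmem : εA ∈ Subgroup.closure (bS '' {y | y ∉ Sm}) := by
    rw [hεx]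
    refine comm_prod_ite_mem _ _ (fun i hi => ?_) (fun i hi => ?_)
    · rw [← ha i]
      exact Subgroup.subset_closure ⟨_, fun h => by have := (hml _).mp h; simp only at this; omega, rfl⟩
    · rw [← hb i]
      exact Subgroup.subset_closure ⟨_, fun h => by have := (hml _).mp h; simp only at this; omega, rfl⟩
  have hηS₁ : η ∈ Subgroup.closure (bS '' S₁) := by
    refine Subgroup.closure_mono ?_ hηcl
    rintro x ⟨i, hi, rfl | rfl⟩
    · exact ⟨Sum.inl (i, false), (h1l _).mpr hi, ha i⟩
    · exact ⟨Sum.inl (i, true), (h1l _).mpr hi, hb i⟩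
  have hηmem : η ∈ Subgroup.closure (bS '' {y | y ∉ Sm}) := by
    refine Subgroup.closure_mono (Set.image_mono fun y hy => ?_) hηS₁
    rcases y with ⟨i, bit⟩ | j
    · exact fun h => by have h1 := (h1l _).mp hy; have h2 := (hml _).mp h; simp only at h1 h2; omega
    · exact absurd hy (h1r j)
  -- the three vertex groups
  have hA₀ : G.vertGp v₀ = ((Subgroup.closure (bS '' S₀)).map ι).topologicalClosure := by
    rw [hV₀]
    congr 2
    apply le_antisymm
    · rw [Subgroup.closure_le]
      rintro x (⟨i, hi, rfl | rfl⟩ | ⟨j, hj, -⟩)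
      · exact Subgroup.subset_closure ⟨Sum.inl (i, false), (h0l _).mpr hi, ha i⟩
      · exact Subgroup.subset_closure ⟨Sum.inl (i, true), (h0l _).mpr hi, hb i⟩
      · exact absurd hj (by omega)
    · rw [Subgroup.closure_le]
      rintro _ ⟨y, hy, rfl⟩
      apply Subgroup.subset_closure
      rcases y with ⟨i, _ | _⟩ | j
      · exact Or.inl ⟨i, (h0l _).mp hy, Or.inl (ha i)⟩
      · exact Or.inl ⟨i, (h0l _).mp hy, Or.inr (hb i)⟩
      · exact absurd hy (h0r j)
  have hAm : G.vertGp vm = ((Subgroup.closure (bS '' Sm ∪ {εA, η})).map ι).topologicalClosure := by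
    rw [hVm, hSm, closure_chainMid_unmarkedEnds_eq hεA hη ha hb hc hg]
  have hA₁ : G.vertGp v₁ = ((Subgroup.closure (bS '' S₁)).map ι).topologicalClosure := by
    rw [hV₁]
    congr 2
    apply le_antisymm
    · rw [Subgroup.closure_le]
      rintro x (⟨i, hi, rfl | rfl⟩ | ⟨j, hj, -⟩ | rfl)
      · exact Subgroup.subset_closure ⟨Sum.inl (i, false), (h1l _).mpr hi, ha i⟩
      · exact Subgroup.subset_closure ⟨Sum.inl (i, true), (h1l _).mpr hi, hb i⟩
      · exact absurd hj (Nat.not_lt_zero _)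
      · exact hηS₁
    · rw [Subgroup.closure_le]
      rintro _ ⟨y, hy, rfl⟩
      apply Subgroup.subset_closure
      rcases y with ⟨i, _ | _⟩ | j
      · exact Or.inl ⟨i, (h1l _).mp hy, Or.inl (ha i)⟩
      · exact Or.inl ⟨i, (h1l _).mp hy, Or.inr (hb i)⟩
      · exact absurd hy (h1r j)
  -- membership helpers and witnesses
  have hcl : ∀ (S : Set ((Fin (g₁ + g₂) × Bool) ⊕ Fin r')) (T : Set (PuncturedSurfaceGroup (g₁ + g₂) (r' + 1)))
      (y), y ∈ S → ι (bS y) ∈ ((Subgroup.closure (bS '' S ∪ T)).map ι).topologicalClosure := fun S T y hy =>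
    Subgroup.le_topologicalClosure _ (Subgroup.mem_map_of_mem ι (Subgroup.subset_closure (Or.inl ⟨y, hy, rfl⟩)))
  have hcl' : ∀ (S : Set ((Fin (g₁ + g₂) × Bool) ⊕ Fin r')) (y), y ∈ S →
      ι (bS y) ∈ ((Subgroup.closure (bS '' S)).map ι).topologicalClosure := fun S y hy =>
    Subgroup.le_topologicalClosure _ (Subgroup.mem_map_of_mem ι (Subgroup.subset_closure ⟨y, hy, rfl⟩))
  have hτm : (Sum.inr ⟨0, by omega⟩ : (Fin (g₁ + g₂) × Bool) ⊕ Fin r') ∈ Sm := hmr _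
  have hτ0 : (Sum.inr ⟨0, by omega⟩ : (Fin (g₁ + g₂) × Bool) ⊕ Fin r') ∉ S₀ := h0r _
  have hτ1 : (Sum.inr ⟨0, by omega⟩ : (Fin (g₁ + g₂) × Bool) ⊕ Fin r') ∉ S₁ := h1r _
  have hκ0 : (Sum.inl (⟨0, by omega⟩, false) : (Fin (g₁ + g₂) × Bool) ⊕ Fin r') ∈ S₀ :=
    (h0l _).mpr (by simp only; omega)
  have hκ1 : (Sum.inl (⟨0, by omega⟩, false) : (Fin (g₁ + g₂) × Bool) ⊕ Fin r') ∉ S₁ := fun h => by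
    have := (h1l _).mp h; simp only at this; omega
  have hmu1 : (Sum.inl (⟨g₁, by omega⟩, false) : (Fin (g₁ + g₂) × Bool) ⊕ Fin r') ∈ S₁ :=
    (h1l _).mpr (by simp only; exact le_rfl)
  have hmu0 : (Sum.inl (⟨g₁, by omega⟩, false) : (Fin (g₁ + g₂) × Bool) ⊕ Fin r') ∉ S₀ := fun h => by
    have := (h0l _).mp h; simp only at this; omega
  -- the free-factor projections killing `S₀`, `S₁`
  let ρ₀ : PuncturedSurfaceGroup (g₁ + g₂) (r' + 1) →* PuncturedSurfaceGroup (g₁ + g₂) (r' + 1) :=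
    bS.lift fun y => if y ∈ S₀ then 1 else bS y
  have hρ₀ : ∀ y, ρ₀ (bS y) = if y ∈ S₀ then 1 else bS y := fun y => lift_apply_basis bS _ y
  let ρ₁ : PuncturedSurfaceGroup (g₁ + g₂) (r' + 1) →* PuncturedSurfaceGroup (g₁ + g₂) (r' + 1) :=
    bS.lift fun y => if y ∈ S₁ then 1 else bS y
  have hρ₁ : ∀ y, ρ₁ (bS y) = if y ∈ S₁ then 1 else bS y := fun y => lift_apply_basis bS _ y
  refine G.verticialSeparatingCoverings_of_sameVertex_of_crossVertex (fun V hVn hVo v γ₁ γ₂ hne => ?_)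
    (fun V hVn hVo w₁ w₂ γ₁ γ₂ h12 => ?_)
  · -- same vertex
    haveI := hVn
    rcases hV v with rfl | rfl | rfl
    · exact freeFactor_exists_open_separating_sameVertex hι bS S₀ ⟨_, hκ0⟩ hℓ hℓS (G.vertGp v) hA₀ V hVo γ₁ γ₂
        hne
    · -- the middle vertex: cut-off twist with `Ψ = c_1^∨`, `E = {ε_A, η}`
      let Ψ : PuncturedSurfaceGroup (g₁ + g₂) (r' + 1) →* Multiplicative ℤ :=
        bS.lift fun y => if y = Sum.inr ⟨0, by omega⟩ then ofAdd 1 else 1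
      have hΨ : ∀ y, Ψ (bS y) = if y = Sum.inr ⟨0, by omega⟩ then ofAdd 1 else 1 := fun y =>
        lift_apply_basis bS _ y
      refine cutoff_exists_open_separating_sameVertex hι bS Sm Ψ (fun y hy => ?_) {εA, η} ?_ _ rfl hτm ?_ hℓ
        hℓS (G.vertGp v) hAm V hVo γ₁ γ₂ hne
      · rw [hΨ, if_neg (fun h => hy (by rw [h]; exact hτm))]
      · rintro x (rfl | rfl)
        · exact Subgroup.closure_mono (Set.image_mono fun y hy => fun h => absurd h hy) hεmem
        · exact Subgroup.closure_mono (Set.image_mono fun y hy => fun h => absurd h hy) hηmem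
      · rw [hΨ, if_pos rfl]
        exact fun h => one_ne_zero (Multiplicative.ofAdd.injective (h.trans ofAdd_zero.symm))
    · exact freeFactor_exists_open_separating_sameVertex hι bS S₁ ⟨_, hmu1⟩ hℓ hℓS (G.vertGp v) hA₁ V hVo γ₁ γ₂
        hne
  · -- different vertices
    haveI := hVn
    have hVi : IsSigmaInteger Sigma V.index := hι.index_open V hVn hVo
    have hmpos : 0 < V.index := hVi.1
    have hmlt : V.index < ℓ ^ V.index := Nat.lt_pow_self hℓ.one_lt
    haveI : NeZero (ℓ ^ V.index) := ⟨pow_ne_zero _ hℓ.ne_zero⟩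
    have hZM : IsSigmaInteger Sigma (Nat.card (Multiplicative (ZMod (ℓ ^ V.index)))) := by
      rw [show Nat.card (Multiplicative (ZMod (ℓ ^ V.index))) = ℓ ^ V.index from Nat.card_zmod _]
      exact Literature.AnabelianGeometry.SemiGraphs.isSigmaInteger_prime_pow hℓ hℓS _
    have hpow1 : (ofAdd (1 : ZMod (ℓ ^ V.index))) ^ V.index ≠ 1 := by
      rw [← ofAdd_nsmul, nsmul_eq_mul, mul_one, Ne, ofAdd_eq_one, ZMod.natCast_eq_zero_iff]
      exact fun h => absurd (Nat.le_of_dvd hmpos h) (not_le.mpr hmlt)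
    -- the handle character `a_{i₀}^∨` (trivial on all `c_j`) kills `Π_{v_mid}` for `i₀` off `C_mid`
    have hkillm : ∀ i₀ : Fin (g₁ + g₂), ((i₀ : ℕ) < g₀ ∨ g₁ ≤ (i₀ : ℕ)) →
        ∃ χ : PuncturedSurfaceGroup (g₁ + g₂) (r' + 1) →* Multiplicative (ZMod (ℓ ^ V.index)),
          χ (a i₀) = ofAdd 1 ∧ ∀ x ∈ Subgroup.closure (bS '' Sm ∪ {εA, η}), χ x = 1 := by
      intro i₀ hi₀
      obtain ⟨χ, hχa, hχb, hχc⟩ := exists_handleCuspCharacter (g := g₁ + g₂) (r := r' + 1)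
        (n := ℓ ^ V.index) (fun i => if i = i₀ then (1 : ZMod (ℓ ^ V.index)) else 0) (fun _ => 0) (fun _ => 0)
        (by simp only [Finset.sum_const_zero])
      refine ⟨χ, by rw [hχa, if_pos rfl], fun x hx => ?_⟩
      refine (Subgroup.closure_le (K := χ.ker)).mpr ?_ hx
      rintro z (⟨y, hy, rfl⟩ | rfl | rfl)
      · rw [SetLike.mem_coe, MonoidHom.mem_ker]
        rcases y with ⟨i, _ | _⟩ | j
        · have h := (hml _).mp hy
          rw [ha, hχa, if_neg (fun h' => by rw [h'] at h; simp only at h; omega), ofAdd_zero]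
        · rw [hb, hχb, ofAdd_zero]
        · rw [hc, hχc, ofAdd_zero]
      · rw [SetLike.mem_coe, MonoidHom.mem_ker, hεA, character_nodeLoop χ hχc g₀ (r' + 1)]
        simp only [ite_self, Finset.sum_const_zero, ofAdd_zero]
      · rw [SetLike.mem_coe, MonoidHom.mem_ker, hη, character_nodeLoop χ hχc g₁ 0]
        simp only [ite_self, Finset.sum_const_zero, ofAdd_zero]
    by_cases h2 : w₂ = vm
    · -- killed: the middle vertex
      rw [h2] at h12 ⊢
      rcases hV w₁ with h1 | h1 | h1
      · obtain ⟨χ, hχ1, hχ0⟩ := hkillm ⟨0, by omega⟩ (Or.inl (by simp only; omega))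
        exact exists_open_separating_of_hom hι hZM χ (G.vertGp vm) _ hAm hχ0 (G.vertGp w₁) (a ⟨0, by omega⟩)
          (by rw [h1, hA₀, ← ha]; exact hcl' S₀ _ hκ0) V hVo (by rw [hχ1]; exact hpow1) γ₁ γ₂
      · exact absurd h1 h12
      · obtain ⟨χ, hχ1, hχ0⟩ := hkillm ⟨g₁, by omega⟩ (Or.inr (by simp only; exact le_rfl))
        exact exists_open_separating_of_hom hι hZM χ (G.vertGp vm) _ hAm hχ0 (G.vertGp w₁) (a ⟨g₁, by omega⟩)
          (by rw [h1, hA₁, ← ha]; exact hcl' S₁ _ hmu1) V hVo (by rw [hχ1]; exact hpow1) γ₁ γ₂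
    · by_cases h2' : w₂ = v₀
      · -- killed: `v₀` (free factor `S₀`); witnesses: the cusp letter `c_1` (alive `v_mid`), `a_{g₁}` (`v₁`)
        rw [h2'] at h12 h2 ⊢
        rcases hV w₁ with h1 | h1 | h1
        · exact absurd h1 h12
        · refine freeFactor_exists_open_separating_crossVertex hι hSig bS S₀ ρ₀ hρ₀ (G.vertGp v₀) hA₀
            (G.vertGp w₁) _ (by rw [h1, hAm]; exact hcl Sm {εA, η} _ hτm) ?_ V hVo γ₁ γ₂
          rw [hρ₀, if_neg hτ0]; exact FreeGroupBasis.apply_ne_one _ _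
        · refine freeFactor_exists_open_separating_crossVertex hι hSig bS S₀ ρ₀ hρ₀ (G.vertGp v₀) hA₀
            (G.vertGp w₁) _ (by rw [h1, hA₁]; exact hcl' S₁ _ hmu1) ?_ V hVo γ₁ γ₂
          rw [hρ₀, if_neg hmu0]; exact FreeGroupBasis.apply_ne_one _ _
      · -- killed: `v₁` (free factor `S₁`); witnesses `a₀` (alive `v₀`), `c_1` (alive `v_mid`)
        have hw₂ : w₂ = v₁ := by
          rcases hV w₂ with h | h | h
          · exact absurd h h2'
          · exact absurd h h2
          · exact h
        rw [hw₂] at h12 ⊢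
        rcases hV w₁ with h1 | h1 | h1
        · refine freeFactor_exists_open_separating_crossVertex hι hSig bS S₁ ρ₁ hρ₁ (G.vertGp v₁) hA₁
            (G.vertGp w₁) (bS (Sum.inl (⟨0, by omega⟩, false))) (by rw [h1, hA₀]; exact hcl' S₀ _ hκ0) ?_
            V hVo γ₁ γ₂
          rw [hρ₁, if_neg hκ1]
          exact FreeGroupBasis.apply_ne_one _ _
        · refine freeFactor_exists_open_separating_crossVertex hι hSig bS S₁ ρ₁ hρ₁ (G.vertGp v₁) hA₁
            (G.vertGp w₁) _ (by rw [h1, hAm]; exact hcl Sm {εA, η} _ hτm) ?_ V hVo γ₁ γ₂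
          rw [hρ₁, if_neg hτ1]; exact FreeGroupBasis.apply_ne_one _ _
        · exact absurd h1 h12

end PSCDatum

end Literature.AnabelianGeometry.SemiGraphs

end
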